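import Literature.NumberTheory.EllipticCurves.GreenbergVatsal2000.CharacterPAdicLFunctionUniquenessProofs
import Literature.NumberTheory.EllipticCurves.KubotaLeopoldtIwasawaFunctionCharacterProofs
import HarnessLib

/-!
# Greenberg–Vatsal 2000, §3 pp. 41–42, displays (26)/(27): the values of `L_{Σ₀}(C, T)` and
# `L_{Σ₀}(D, T)` at the character points `T = ρ(γ) − 1` of `Γ`

GV p. 41: "The `p`-adic `L`-function `L(C, χ, T) ∈ Λ` is characterized by the interpolation
property `L(C, χ, ζ − 1) = L(C, χρ, 1) = L(χψ⁻¹ρ, 0)` (26) for every nontrivial character `ρ` of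
`Γ = Gal(ℚ_∞/ℚ)`. As before, `ζ = ρ(γ)` …"; p. 42: "one multiplies `L(C, χ, T)` by the `l`-th
Euler factors `1 − χψ⁻¹(l)(1 + T)^{f_l}` for each `l ∈ Σ₀`. … The value at `T = ζ − 1` is the
`l`-th Euler factor `1 − χψ⁻¹ρ(l)` in `L(χψ⁻¹ρ, s)` at `s = 0`. … (27) …
`L_p(ωχ⁻¹ψ⁻¹, s) = ½ L(D, χ, κ(γ)^s − 1)` … one multiplies by the Euler factors
`1 − χψ(l)l⁻¹(1 + T)^{f_l}` … The value at `T = ζ − 1` is the `l`-th Euler factor `1 − χψρ(l)l⁻¹`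
in `L(χψρ, s)` at `s = 1`."  With the classical special value `L(θ, 0) = −B_{1,θ}` for a
non-trivial Dirichlet character `θ` (Washington Thm. 4.2; Lang Ch. 2 §2 **B 7**:
`B_{1,θ} = ∑_{x mod M} θ(x) B_1(x/M)`, `B_1(X) = X − ½`), display (26) at `χ = 1` reads
`L_{Σ₀}(C, ρ(γ) − 1) = −B_{1,(ψ⁻¹ρ)·1_{Σ₀}}`, `ψ⁻¹ = φω⁻¹` (p. 28 `φψ = ω`).

The tree DEFINES `L_{Σ₀}(C, T)`, `L_{Σ₀}(D, T)` by the predicates `IsCharacterLFunctionC/D`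
(`CharacterPAdicLFunctions.lean`: GV's Kubota–Leopoldt relations read at `s = 1 − k`), proves
their existence (`CharacterPAdicLFunctionExistenceProofs`, fact F0 = A223 a theorem) and
uniqueness (`CharacterPAdicLFunctionUniquenessProofs`). This file proves that THE element so
defined satisfies GV's display (26) at `χ = 1` VERBATIM, and the corresponding statement for `D`:

* `IsCharacterLFunctionC.hasSum_character` — for every `g` with `IsCharacterLFunctionC p φ Σ₀ g`,
  every `n` and every character `ρ` of `Γ` of conductor dividing `p^{n+1}` (even Dirichlet
  character modulo `p^{n+1}` of `p`-power order with values in `ℂ_p`):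
  `g(ρ(γ) − 1) = −∑_{i < M} (φω⁻¹·1_{(·,pΣ₀)=1})(i) ρ(i) B_1(i/M)`, `M = mp(∏_{Σ₀}ℓ)·p^{n+1}` — i.e.
  `= −B_{1,(φω⁻¹ρ)·1_{Σ₀}} = L(ψ⁻¹ρ, 0)·∏_{l∈Σ₀}(1 − ψ⁻¹ρ(l))`, display (26) with the `Σ₀`-Euler
  factors at `s = 0` (for `ρ = 1` this is the `k = 1` clause of the predicate, by the distribution
  relation);
* `IsCharacterLFunctionD.hasSum_character` — for every `g` with `IsCharacterLFunctionD p ψ Σ₀ g`: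
  `g(ρ(γ) − 1) = 2·(−∑_{i < dp·p^{n+1}} (ψ⁻¹·1_{p∤·})(i) ρ⁻¹(i) B_1(i/(dp^{n+2}))) ·
  ∏_{l∈Σ₀}(1 − ψ(l)ρ(l)l⁻¹)` — i.e. `2·L(ψ⁻¹ρ⁻¹, 0)·∏_{l∈Σ₀}(1 − ψρ(l)l⁻¹)`: the character
  `ψ⁻¹ρ⁻¹` and the Euler factors `1 − ψρ(l)l⁻¹` of display (27), with the factor `2` of the
  tree's normalisation "`L_p(ωψ⁻¹, s) = ½ L(D, κ(γ)^s − 1)`" (p. 42). READING NOTE for the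
  referee's D-audit: GV's two printed sentences for `D` — (27) "`L(D, χ, ζ − 1) = …
  = ½ L(χ⁻¹ψ⁻¹ρ⁻¹, 0)`" and "`L_p(ωχ⁻¹ψ⁻¹, s) = ½ L(D, χ, κ(γ)^s − 1)`" — differ from each other by
  the factor `4 ∈ ℤ_pˣ` (`p` odd) at `ρ → 1`; the tree follows the second (the predicate
  `IsCharacterLFunctionD`), so its `L_{Σ₀}(D, T)` is `4×` the function of display (27) as printed;
  `μ`- and `λ`-invariants (the only use GV make of `L(D, T)`, Prop. 3.11 ff.) are unaffected.

Method: the Kubota–Leopoldt–Iwasawa construction of the existence proof is re-run with the value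
at `ρ(γ) − 1` retained (`exists_iwasawaFunction_of_bernoulliMeasure_character`: transform of the
Bernoulli measure at a character = character sum (Mazur–Tate–Teitelbaum §I.13) = `(1 − θρ(c)c)
B_{1,θρ}` (Lang Ch. 2 Thm. 2.4), divided by the regulariser's value `1 − θ(c)cρ(γ^{e}) =
1 − θρ(c)c`), and uniqueness transports the value to every `g` satisfying the predicate.

Everything is proved; there are no named facts and no new definitions.

## Citation header (held text `paper:arxiv-math_9906215`, decoded dvips stream
## `HOME/b2b-bsdres-eisenstein-p2/gv2000_decoded.gen21.txt`: p. 41 = p0064, p. 42 = p0065)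

See the quotations above and in `CharacterPAdicLFunctions.lean`. References:
[GreenbergVatsal2000] §3 pp. 41–42, displays (26)–(27); [LangCyclotomic1990] Ch. 2 §2 B 7,
Thm. 2.4, Ch. 4 §3 Thm. 3.2; Washington, GTM 83, Thm. 4.2, §7.2, Thm. 12.2;
[MazurTateTeitelbaum1986] §I.13.
-/

noncomputable section

open scoped Classical

open NumberField IsDedekindDomain Finset PowerSeries Literature.NumberTheory.EllipticCurves

namespace Literature.NumberTheory.EllipticCurves.GreenbergVatsal2000

open CyclotomicZp PadicOneUnits

variable (p : ℕ) [Fact p.Prime]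

/-! ### Small facts re-proved here (private in their home files) -/

/-- `θ_k` on an integer prime to `pΣ₀`: `θ_k(c) = ω(φ(c)c̄^{-k})`. [folklore] -/
private theorem depletedEvenCharacterTwist_of_not_dvd' {m : ℕ} (φ : DirichletCharacter (ZMod p) m)
    (S₀ : Finset (HeightOneSpectrum (𝓞 ℚ))) (k : ℕ) {c : ℕ} (hpc : ¬ p ∣ c)
    (hSc : ¬ ∃ v ∈ S₀, Rat.HeightOneSpectrum.natGenerator v ∣ c) :
    depletedEvenCharacterTwist p φ S₀ k c =
      teichmullerLift p (φ (c : ZMod m) * ((c : ZMod p)⁻¹) ^ k) := by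
  unfold depletedEvenCharacterTwist evenCharacterTwist
  rw [if_neg hSc, if_neg hpc]

/-- `N = m p ∏ ℓ_v ≠ 0`. [folklore] -/
private theorem depletedModulus_ne_zero' {m : ℕ} [NeZero m] (S₀ : Finset (HeightOneSpectrum (𝓞 ℚ))) :
    depletedModulus p S₀ m ≠ 0 := by
  unfold depletedModulus
  exact mul_ne_zero (mul_ne_zero (NeZero.ne m) (Fact.out : p.Prime).ne_zero)
    (Finset.prod_ne_zero_iff.mpr fun v _ ↦ (Rat.HeightOneSpectrum.prime_natGenerator v).ne_zero)

omit [Fact p.Prime] in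
/-- `(p : 𝓞 ℚ) ∉ v` implies `ℓ_v ≠ p`. [folklore] -/
private theorem natGenerator_ne_of_natCast_not_mem' {v : HeightOneSpectrum (𝓞 ℚ)}
    (h : ((p : ℕ) : 𝓞 ℚ) ∉ v.asIdeal) : Rat.HeightOneSpectrum.natGenerator v ≠ p := by
  intro hgen
  apply h
  have hdvd : Rat.HeightOneSpectrum.natGenerator v ∣ p := hgen ▸ dvd_refl _
  rw [Rat.HeightOneSpectrum.natGenerator_dvd_iff] at hdvd
  obtain ⟨x, hx, hxe⟩ := (Ideal.mem_map_of_equiv _ _).mp hdvd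
  have : x = (p : 𝓞 ℚ) := by
    apply (Rat.IsIntegralClosure.intEquiv (𝓞 ℚ)).injective
    rw [hxe, map_natCast]
  rwa [this] at hx

omit [Fact p.Prime] in
/-- Summing a function of `b.val` over `ℤ/Mℤ` is summing over `0 ≤ i < M`. [folklore] -/
private theorem sum_univ_zmod_apply_val_eq' {M : ℕ} [NeZero M] {R : Type*} [AddCommMonoid R]
    (G : ℕ → R) : ∑ b : ZMod M, G b.val = ∑ i ∈ Finset.range M, G i := by
  obtain ⟨M', rfl⟩ := Nat.exists_eq_succ_of_ne_zero (NeZero.ne M)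
  exact Fin.sum_univ_eq_sum_range G (M' + 1)

/-- The sum `∑_{b mod M} ρ̃(b̄)θ(b)B_1^{(M)}(b)` of the measure-theoretic files, rewritten as the
generalized Bernoulli number `∑_{i<M} θ(i)ρ̃(i)B_1(i/M)` (Lang **B 7** at `k = 1`). [cite: LangCyclotomic1990, Ch. 2 §2, B 7 (PDF p. 35)] -/
theorem sum_castHom_mul_bernoulliDist_one_eq {M n : ℕ} [NeZero M] (hpM : p ^ n ∣ M)
    (ρ : MulChar (ZMod (p ^ n)) ℂ_[p]) (θ : ℕ → ℤ_[p]) :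
    ∑ b : ZMod M, ρ (ZMod.castHom hpM (ZMod (p ^ n)) b) *
        algebraMap ℚ_[p] ℂ_[p] (((θ b.val : ℤ_[p]) : ℚ_[p]) * ((bernoulliDist 1 M b : ℚ) : ℚ_[p])) =
      ∑ i ∈ Finset.range M, ((algebraMap ℚ_[p] ℂ_[p]).comp (algebraMap ℤ_[p] ℚ_[p])) (θ i) *
        ρ (i : ZMod (p ^ n)) * (((Polynomial.bernoulli 1).eval ((i : ℚ) / M) : ℚ) : ℂ_[p]) := by
  rw [← sum_univ_zmod_apply_val_eq' (M := M) (fun i ↦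
    ((algebraMap ℚ_[p] ℂ_[p]).comp (algebraMap ℤ_[p] ℚ_[p])) (θ i) *
      ρ (i : ZMod (p ^ n)) * (((Polynomial.bernoulli 1).eval ((i : ℚ) / M) : ℚ) : ℂ_[p]))]
  refine Finset.sum_congr rfl fun b _ ↦ ?_
  rw [ZMod.castHom_apply, ZMod.cast_eq_val, bernoulliDist, pow_zero, one_mul, map_mul,
    RingHom.comp_apply, PadicInt.algebraMap_apply, map_ratCast]
  ring

/-! ### `L_{Σ₀}(C, T)` at the character points: display (26) -/

section C

variable {m : ℕ} [NeZero m] (φ : DirichletCharacter (ZMod p) m)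
  (S₀ : Finset (HeightOneSpectrum (𝓞 ℚ)))

/-- **Existence of `L_{Σ₀}(C, T)` with its values at the character points** — the construction of
`exists_isCharacterLFunctionC` (Lang Ch. 4 §3 Thm. 3.2 for the measure `θE_{1,c}`,
`θ = φω⁻¹·1_{(·,pΣ₀)=1}`, divided by the unit `1 − θ(c)c(1+T)^{e}`) re-run with the value at
`T = ρ(γ) − 1` retained: `g(ρ(γ) − 1) = −∑_{b mod Np^{n+1}} ρ(b̄)θ(b)B_1(b.val/(Np^{n+1}))`
(GV (26) at `χ = 1`: `L(C, ζ − 1) = L(ψ⁻¹ρ, 0)` with the `Σ₀`-Euler factors at `s = 0`).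
[cite: GreenbergVatsal2000, §3 pp. 41–42 (display (26) and the Σ₀-Euler factors at T = ζ − 1)]
[cite: LangCyclotomic1990, Ch. 4 §3, Thm. 3.2 (PDF p. 84) and Ch. 2 §2 Thm. 2.4 (PDF p. 38)] -/
theorem exists_isCharacterLFunctionC_character (hp : p ≠ 2) (hpm : p ∣ m) (hφ : φ.IsPrimitive) :
    ∃ g : IwasawaAlgebra p, IsCharacterLFunctionC p φ S₀ g ∧
      ∀ (n : ℕ) (ρ : DirichletCharacter ℂ_[p] (p ^ (n + 1))), ρ.Even →
        (∃ j : ℕ, orderOf ρ = p ^ j) →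
        HasSum (fun k ↦ ((algebraMap ℚ_[p] ℂ_[p]).comp (algebraMap ℤ_[p] ℚ_[p]))
            (PowerSeries.coeff k g) * (ρ (cyclotomicGenerator p : ZMod (p ^ (n + 1))) - 1) ^ k)
          (-(∑ i ∈ Finset.range (depletedModulus p S₀ m * p ^ (n + 1)),
            ((algebraMap ℚ_[p] ℂ_[p]).comp (algebraMap ℤ_[p] ℚ_[p]))
                (depletedEvenCharacterTwist p φ S₀ 1 i) * ρ (i : ZMod (p ^ (n + 1))) *
              (((Polynomial.bernoulli 1).eval
                ((i : ℚ) / (depletedModulus p S₀ m * p ^ (n + 1) : ℕ)) : ℚ) : ℂ_[p]))) := by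
  have pp : p.Prime := Fact.out
  obtain ⟨c, hcN, hpc, hSc, hφc⟩ := exists_regulariser_C p φ S₀ hpm hφ
  haveI : NeZero (depletedModulus p S₀ m) := ⟨depletedModulus_ne_zero' p S₀⟩
  have hc0 : (c : ZMod p) ≠ 0 := fun h ↦ hpc ((ZMod.natCast_eq_zero_iff c p).mp h)
  have hunit : IsUnit (1 - depletedEvenCharacterTwist p φ S₀ 1 c * c : ℤ_[p]) := by
    apply isUnit_of_toZMod_ne_zero
    rw [map_sub, map_one, map_mul, map_natCast, depletedEvenCharacterTwist_of_not_dvd' p φ S₀ 1 hpc hSc,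
      toZMod_teichmullerLift, pow_one, mul_assoc, inv_mul_cancel₀ hc0, mul_one, sub_ne_zero]
    exact Ne.symm hφc
  obtain ⟨g, _g', hg, hgchar⟩ := exists_iwasawaFunction_of_bernoulliMeasure_character p hp hcN
    (θ := depletedEvenCharacterTwist p φ S₀ 1)
    (depletedEvenCharacterTwist_add_depletedModulus p φ S₀ 1)
    (fun b hb ↦ depletedEvenCharacterTwist_eq_zero_of_dvd p φ S₀ 1 hb)
    (depletedEvenCharacterTwist_mul p φ S₀ 1 c) hunit
    (fun j ↦ depletedEvenCharacterTwist p φ S₀ (j + 1))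
    (fun j ↦ depletedEvenCharacterTwist_add_depletedModulus p φ S₀ (j + 1))
    (fun j b hb ↦ depletedEvenCharacterTwist_eq_zero_of_dvd p φ S₀ (j + 1) hb)
    (fun j ↦ depletedEvenCharacterTwist_mul p φ S₀ (j + 1) c)
    (fun j b η hb ↦ depletedEvenCharacterTwist_twist p φ S₀ hp j b η hb)
  refine ⟨g, fun k hk ↦ ?_, fun n ρ heven hord ↦ ?_⟩
  · obtain ⟨j, rfl⟩ : ∃ j, k = j + 1 := ⟨k - 1, by omega⟩
    have h := (hg j).1
    simp only [Nat.add_sub_cancel]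
    convert h using 1
    unfold characterLValueC twistedBernoulli
    rw [Nat.add_sub_cancel, one_div, neg_mul]
  · haveI : NeZero (depletedModulus p S₀ m * p ^ (n + 1)) :=
      ⟨mul_ne_zero (depletedModulus_ne_zero' p S₀) (pow_ne_zero _ pp.ne_zero)⟩
    have h := (hgchar n ρ heven hord).1
    rw [sum_castHom_mul_bernoulliDist_one_eq p (Dvd.intro_left _ rfl) ρ] at h
    simpa only [Nat.cast_mul, Nat.cast_pow] using h

/-- **Greenberg–Vatsal (26) at `χ = 1` for the tree's `L_{Σ₀}(C, T)`**: for every `g ∈ Λ` with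
`IsCharacterLFunctionC p φ Σ₀ g` (`p` odd, `φ` primitive modulo `m`, `p ∣ m`), every `n` and
every character `ρ` of `Γ` of conductor dividing `p^{n+1}` (an even Dirichlet character modulo
`p^{n+1}` of `p`-power order with values in `ℂ_p`, `ζ = ρ(γ)`, `γ = κ(γ) = 1 + p`),
`g(ζ − 1) = −∑_{i<M} θ(i)ρ(i)B_1(i/M) = −B_{1,θρ}`, `θ = φω⁻¹·1_{(·,pΣ₀)=1}`, `M = mp(∏_{Σ₀}ℓ)p^{n+1}`
— GV p. 41 (26) "`L(C, χ, ζ − 1) = L(C, χρ, 1) = L(χψ⁻¹ρ, 0)`" with p. 42 "The value at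
`T = ζ − 1` is the `l`-th Euler factor `1 − χψ⁻¹ρ(l)` in `L(χψ⁻¹ρ, s)` at `s = 0`" and
`L(θ', 0) = −B_{1,θ'}` (Washington Thm. 4.2), `ψ⁻¹ = φω⁻¹` (p. 28). No restriction to
non-trivial `ρ` is needed in this form. [cite: GreenbergVatsal2000, §3 pp. 41–42 (display (26); the Σ₀-Euler factors at T = ζ − 1)]
[cite: LangCyclotomic1990, Ch. 2 §2 B 7 (B_{1,θ}) and Ch. 4 §3 Thm. 3.2] -/
theorem IsCharacterLFunctionC.hasSum_character (hp : p ≠ 2) (hpm : p ∣ m) (hφ : φ.IsPrimitive)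
    {g : IwasawaAlgebra p} (hg : IsCharacterLFunctionC p φ S₀ g) (n : ℕ)
    (ρ : DirichletCharacter ℂ_[p] (p ^ (n + 1))) (heven : ρ.Even) (hord : ∃ j : ℕ, orderOf ρ = p ^ j) :
    HasSum (fun k ↦ ((algebraMap ℚ_[p] ℂ_[p]).comp (algebraMap ℤ_[p] ℚ_[p]))
        (PowerSeries.coeff k g) * (ρ (cyclotomicGenerator p : ZMod (p ^ (n + 1))) - 1) ^ k)
      (-(∑ i ∈ Finset.range (depletedModulus p S₀ m * p ^ (n + 1)),
        ((algebraMap ℚ_[p] ℂ_[p]).comp (algebraMap ℤ_[p] ℚ_[p])) (depletedEvenCharacterTwist p φ S₀ 1 i) *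
          ρ (i : ZMod (p ^ (n + 1))) *
          (((Polynomial.bernoulli 1).eval ((i : ℚ) / (depletedModulus p S₀ m * p ^ (n + 1) : ℕ)) : ℚ) :
            ℂ_[p]))) := by
  obtain ⟨g₀, hg₀, hchar⟩ := exists_isCharacterLFunctionC_character p φ S₀ hp hpm hφ
  rw [IsCharacterLFunctionC.unique φ S₀ hg hg₀]
  exact hchar n ρ heven hord

end C

/-! ### `L_{Σ₀}(D, T)` at the character points: display (27) (tree normalisation) -/

section D

variable {d : ℕ} (ψ : DirichletCharacter (ZMod p) d) (S₀ : Finset (HeightOneSpectrum (𝓞 ℚ)))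

/-- Values of finite products of elements of `Λ` at a point of the open unit disc of `ℂ_p`
(multiplicativity of evaluation). [cite: LangCyclotomic1990, Ch. 4 §1, Thm. 1.2 (PDF p. 79)] -/
theorem hasSum_cpCoeff_prod {ι : Type*} (s : Finset ι) (F : ι → PowerSeries ℤ_[p])
    (a : ι → ℂ_[p]) {z : ℂ_[p]} (hz : ‖z‖ < 1)
    (h : ∀ i ∈ s, HasSum (fun n ↦ ((algebraMap ℚ_[p] ℂ_[p]).comp (algebraMap ℤ_[p] ℚ_[p]))
      (PowerSeries.coeff n (F i)) * z ^ n) (a i)) :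
    HasSum (fun n ↦ ((algebraMap ℚ_[p] ℂ_[p]).comp (algebraMap ℤ_[p] ℚ_[p]))
      (PowerSeries.coeff n (∏ i ∈ s, F i)) * z ^ n) (∏ i ∈ s, a i) := by
  induction s using Finset.induction_on with
  | empty =>
    simp only [Finset.prod_empty]
    exact hasSum_map_coeff_one_mul_pow _ z
  | insert i s hi ih =>
    rw [Finset.prod_insert hi, Finset.prod_insert hi]
    exact hasSum_cpCoeff_mul hz (h i (Finset.mem_insert_self i s))
      (ih fun k hk ↦ h k (Finset.mem_insert_of_mem hk))

/-- **The Euler-factor element at `l ∈ Σ₀` with its value at the character points** (GV p. 42: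
"one multiplies by the Euler factors `1 − χψ(l)l⁻¹(1 + T)^{f_l}` … The value at `T = ζ − 1` is the
`l`-th Euler factor `1 − χψρ(l)l⁻¹` in `L(χψρ, s)` at `s = 1`"): `e_l = 1 − ψ(l)l⁻¹(1+T)^{f_l}`,
`l = ω(l)γ^{f_l}`, has the values `1 − ψ(l)ω(l)^{j}l^{−(j+1)}` at `κ(γ)^{−j} − 1` (as in
`exists_eulerFactorD`) and `1 − ψ(l)ρ(l)l⁻¹` at `ρ(γ) − 1` (`ρ(γ^{f_l}) = ρ(l)`, `ρ(ω(l)) = 1`).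
[cite: GreenbergVatsal2000, §3 p. 42 (the Euler factors of L_{Σ₀}(D,χ,T) and their values at T = ζ − 1)] -/
theorem exists_eulerFactorD_character (hp : p ≠ 2) {ℓ : ℕ} (hℓ : ℓ.Prime) (hℓp : ℓ ≠ p) :
    ∃ e : PowerSeries ℤ_[p], (∀ j : ℕ,
      HasSum (fun n ↦ ((PowerSeries.coeff n e : ℤ_[p]) : ℚ_[p]) *
          ((((cyclotomicGenerator p : ℕ) : ℚ_[p])⁻¹) ^ j - 1) ^ n)
        (1 - ((teichmullerLift p (ψ (ℓ : ZMod d)) * teichmullerLift p (ℓ : ZMod p) ^ j : ℤ_[p]) :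
            ℚ_[p]) * ((ℓ : ℚ_[p])⁻¹) ^ (j + 1))) ∧
      ∀ (n : ℕ) (ρ : DirichletCharacter ℂ_[p] (p ^ n)), ρ.Even → (∃ j : ℕ, orderOf ρ = p ^ j) →
        HasSum (fun k ↦ ((algebraMap ℚ_[p] ℂ_[p]).comp (algebraMap ℤ_[p] ℚ_[p]))
            (PowerSeries.coeff k e) * (ρ (cyclotomicGenerator p : ZMod (p ^ n)) - 1) ^ k)
          (1 - ((algebraMap ℚ_[p] ℂ_[p]).comp (algebraMap ℤ_[p] ℚ_[p]))
            (teichmullerLift p (ψ (ℓ : ZMod d))) * (ℓ : ℂ_[p])⁻¹ * ρ (ℓ : ZMod (p ^ n))) := by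
  have pp : p.Prime := Fact.out
  have hpl : ¬ p ∣ ℓ := fun h ↦ hℓp ((Nat.prime_dvd_prime_iff_eq pp hℓ).mp h).symm
  have hlunit : IsUnit (ℓ : ℤ_[p]) := by
    rw [PadicInt.isUnit_iff, ← PadicInt.padic_norm_e_of_padicInt, PadicInt.coe_natCast,
      Padic.norm_natCast_eq_one_iff]
    exact (Nat.Prime.coprime_iff_not_dvd pp).mpr hpl
  obtain ⟨ζ, f, hlf, hζ⟩ := exists_rootsOfUnity_mul_cycPow p hlunit.unit
  rw [IsUnit.unit_spec] at hlf hζ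
  rw [map_natCast] at hζ
  have hζω : teichmullerLift p (ℓ : ZMod p) = ((ζ : ℤ_[p]ˣ) : ℤ_[p]) := by
    rw [← hζ]; exact teichmullerLift_toZMod_rootsOfUnity p hp ζ
  set a : ℤ_[p] := teichmullerLift p (ψ (ℓ : ZMod d)) * ((hlunit.unit⁻¹ : ℤ_[p]ˣ) : ℤ_[p]) with ha
  refine ⟨1 - PowerSeries.C a * PowerSeries.binomialSeries ℤ_[p] f, fun j ↦ ?_,
    fun n ρ heven hord ↦ ?_⟩
  · have h := hasSum_intCoeff_one_sub_C_mul_binomialSeries p a (-(j : ℤ_[p])) f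
    rw [coe_cycPow_neg_natCast] at h
    convert h using 2
    -- `a γ^{-jf} = ω(ψ l) ω(l)^j l^{-(j+1)}`
    have hℓ0 : (ℓ : ℚ_[p]) ≠ 0 := by exact_mod_cast hℓ.ne_zero
    have hζ0 : (((ζ : ℤ_[p]ˣ) : ℤ_[p]) : ℚ_[p]) ≠ 0 := by
      rw [ne_eq, PadicInt.coe_eq_zero]; exact (ζ : ℤ_[p]ˣ).ne_zero
    have hinv : (((hlunit.unit⁻¹ : ℤ_[p]ˣ) : ℤ_[p]) : ℚ_[p]) = (ℓ : ℚ_[p])⁻¹ := by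
      refine eq_inv_of_mul_eq_one_left ?_
      rw [← PadicInt.coe_natCast, ← PadicInt.coe_mul, hlunit.val_inv_mul, PadicInt.coe_one]
    have hcyc : ((cycPow p f : ℤ_[p]) : ℚ_[p]) = (ℓ : ℚ_[p]) * ((((ζ : ℤ_[p]ˣ) : ℤ_[p]) : ℚ_[p]))⁻¹ := by
      rw [eq_mul_inv_iff_mul_eq₀ hζ0, mul_comm, ← PadicInt.coe_mul, ← hlf, PadicInt.coe_natCast]
    have hneg : ((cycPow p (-(j : ℤ_[p]) * f) : ℤ_[p]) : ℚ_[p]) =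
        (((cycPow p f : ℤ_[p]) : ℚ_[p]) ^ j)⁻¹ := by
      refine eq_inv_of_mul_eq_one_left ?_
      rw [← PadicInt.coe_pow, ← PadicInt.coe_mul, ← AddChar.map_nsmul_eq_pow, nsmul_eq_mul,
        ← AddChar.map_add_eq_mul, neg_mul, neg_add_cancel, AddChar.map_zero_eq_one, PadicInt.coe_one]
    rw [hneg, hcyc, ha]
    push_cast
    rw [hinv, hζω]
    simp only [mul_pow, mul_inv, inv_inv, inv_pow]
    ring
  · -- the value at `ρ(γ) − 1`: `1 − a ρ(γ^f) = 1 − ω(ψ l) l⁻¹ ρ(l)`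
    have h := hasSum_cpCoeff_one_sub_C_mul_binomialSeries_character ρ hord a f
    convert h using 2
    have hlbar : (ℓ : ZMod (p ^ n)) = PadicInt.toZModPow n ((ζ : ℤ_[p]ˣ) : ℤ_[p]) *
        PadicInt.toZModPow n (cycPow p f) := by
      rw [← map_mul, ← hlf, map_natCast]
    have hρl : ρ (ℓ : ZMod (p ^ n)) = ρ (PadicInt.toZModPow n (cycPow p f)) := by
      rw [hlbar, map_mul, apply_toZModPow_rootsOfUnity ρ heven hord ζ, one_mul]
    have hinvC : ((algebraMap ℚ_[p] ℂ_[p]).comp (algebraMap ℤ_[p] ℚ_[p]))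
        ((hlunit.unit⁻¹ : ℤ_[p]ˣ) : ℤ_[p]) = (ℓ : ℂ_[p])⁻¹ := by
      refine eq_inv_of_mul_eq_one_left ?_
      rw [← map_natCast ((algebraMap ℚ_[p] ℂ_[p]).comp (algebraMap ℤ_[p] ℚ_[p])) ℓ, ← map_mul,
        hlunit.val_inv_mul, map_one]
    rw [hρl, ha, map_mul, hinvC]

/-- **Existence of `L_{Σ₀}(D, T)` with its values at the character points** — the construction of
`exists_isCharacterLFunctionD` (the Iwasawa function of the inverted measure of `θE_{1,c}`,
`θ = ψ⁻¹·1_{p∤·}`, times `2` and the Euler-factor elements) re-run with the value at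
`T = ρ(γ) − 1` retained:
`g(ρ(γ) − 1) = 2·(−∑_{b mod dp^{n+2}} ρ⁻¹(b̄)θ(b)B_1(b.val/(dp^{n+2})))·∏_{l∈Σ₀}(1 − ψ(l)l⁻¹ρ(l))`.
[cite: GreenbergVatsal2000, §3 p. 42 (display (27), L_p(ωχ⁻¹ψ⁻¹,s) = ½L(D,χ,κ(γ)^s − 1), the Σ₀-Euler factors at T = ζ − 1)]
[cite: LangCyclotomic1990, Ch. 4 §3, Thm. 3.2 (PDF p. 84) and Ch. 2 §2 Thm. 2.4 (PDF p. 38)] -/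
theorem exists_isCharacterLFunctionD_character [NeZero d] (hp : p ≠ 2) (hpd : ¬ p ∣ d)
    (hS : ∀ v ∈ S₀, ((p : ℕ) : 𝓞 ℚ) ∉ v.asIdeal) :
    ∃ g : IwasawaAlgebra p, IsCharacterLFunctionD p ψ S₀ g ∧
      ∀ (n : ℕ) (ρ : DirichletCharacter ℂ_[p] (p ^ (n + 1))), ρ.Even →
        (∃ j : ℕ, orderOf ρ = p ^ j) →
        HasSum (fun k ↦ ((algebraMap ℚ_[p] ℂ_[p]).comp (algebraMap ℤ_[p] ℚ_[p]))
            (PowerSeries.coeff k g) * (ρ (cyclotomicGenerator p : ZMod (p ^ (n + 1))) - 1) ^ k)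
          (2 * (-(∑ b : ZMod (d * p * p ^ (n + 1)),
            ρ⁻¹ (ZMod.castHom (Dvd.intro_left _ rfl) (ZMod (p ^ (n + 1))) b) *
              algebraMap ℚ_[p] ℂ_[p] (((oddCharacterTwist p ψ 1 b.val : ℤ_[p]) : ℚ_[p]) *
                ((bernoulliDist 1 (d * p * p ^ (n + 1)) b : ℚ) : ℚ_[p])))) *
            ∏ v ∈ S₀, (1 - ((algebraMap ℚ_[p] ℂ_[p]).comp (algebraMap ℤ_[p] ℚ_[p]))
              (teichmullerLift p (ψ (Rat.HeightOneSpectrum.natGenerator v : ZMod d))) *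
                (Rat.HeightOneSpectrum.natGenerator v : ℂ_[p])⁻¹ *
                ρ (Rat.HeightOneSpectrum.natGenerator v : ZMod (p ^ (n + 1))))) := by
  have pp : p.Prime := Fact.out
  obtain ⟨c, hc, hunit⟩ := exists_regulariser_D p hp hpd ψ
  haveI : NeZero (d * p) := ⟨mul_ne_zero (NeZero.ne d) pp.ne_zero⟩
  obtain ⟨_g, g', hg, hgchar⟩ := exists_iwasawaFunction_of_bernoulliMeasure_character p hp hc
    (θ := oddCharacterTwist p ψ 1)
    (oddCharacterTwist_add_mul p ψ 1)
    (fun b hb ↦ oddCharacterTwist_eq_zero_of_dvd p ψ 1 hb)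
    (oddCharacterTwist_mul p ψ 1 c) hunit
    (fun j ↦ oddCharacterTwist p ψ (j + 1))
    (fun j ↦ oddCharacterTwist_add_mul p ψ (j + 1))
    (fun j b hb ↦ oddCharacterTwist_eq_zero_of_dvd p ψ (j + 1) hb)
    (fun j ↦ oddCharacterTwist_mul p ψ (j + 1) c)
    (fun j b η hb ↦ oddCharacterTwist_twist p ψ hp j b η hb)
  -- Euler factors with both value clauses
  have hE : ∀ v : HeightOneSpectrum (𝓞 ℚ), ∃ e : PowerSeries ℤ_[p], v ∈ S₀ → (∀ j : ℕ,
      HasSum (fun n ↦ ((PowerSeries.coeff n e : ℤ_[p]) : ℚ_[p]) *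
          ((((cyclotomicGenerator p : ℕ) : ℚ_[p])⁻¹) ^ j - 1) ^ n)
        (1 - ((teichmullerLift p (ψ (Rat.HeightOneSpectrum.natGenerator v : ZMod d)) *
              teichmullerLift p (Rat.HeightOneSpectrum.natGenerator v : ZMod p) ^ j : ℤ_[p]) :
            ℚ_[p]) * ((Rat.HeightOneSpectrum.natGenerator v : ℚ_[p])⁻¹) ^ (j + 1))) ∧
      ∀ (n : ℕ) (ρ : DirichletCharacter ℂ_[p] (p ^ n)), ρ.Even → (∃ j : ℕ, orderOf ρ = p ^ j) →
        HasSum (fun k ↦ ((algebraMap ℚ_[p] ℂ_[p]).comp (algebraMap ℤ_[p] ℚ_[p]))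
            (PowerSeries.coeff k e) * (ρ (cyclotomicGenerator p : ZMod (p ^ n)) - 1) ^ k)
          (1 - ((algebraMap ℚ_[p] ℂ_[p]).comp (algebraMap ℤ_[p] ℚ_[p]))
            (teichmullerLift p (ψ (Rat.HeightOneSpectrum.natGenerator v : ZMod d))) *
              (Rat.HeightOneSpectrum.natGenerator v : ℂ_[p])⁻¹ *
              ρ (Rat.HeightOneSpectrum.natGenerator v : ZMod (p ^ n))) := by
    intro v
    by_cases hv : v ∈ S₀
    · obtain ⟨e, he⟩ := exists_eulerFactorD_character p ψ hp
        (Rat.HeightOneSpectrum.prime_natGenerator v) (natGenerator_ne_of_natCast_not_mem' p (hS v hv))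
      exact ⟨e, fun _ ↦ he⟩
    · exact ⟨1, fun h ↦ absurd h hv⟩
  choose e he using hE
  refine ⟨PowerSeries.C (2 : ℤ_[p]) * g' * ∏ v ∈ S₀, e v, fun k hk ↦ ?_, fun n ρ heven hord ↦ ?_⟩
  · obtain ⟨j, rfl⟩ : ∃ j, k = j + 1 := ⟨k - 1, by omega⟩
    have hz : ‖(((cyclotomicGenerator p : ℕ) : ℚ_[p])⁻¹) ^ j - 1‖ < 1 :=
      norm_cyclotomicGenerator_inv_pow_sub_one_lt j
    have h2 := hasSum_intCoeff_C_mul_pow (2 : ℤ_[p]) ((((cyclotomicGenerator p : ℕ) : ℚ_[p])⁻¹) ^ j - 1)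
    have hg' := (hg j).2
    have hprod := hasSum_intCoeff_prod_mul_pow p S₀ e _ hz fun v hv ↦ (he v hv).1 j
    have h := hasSum_intCoeff_mul_mul_pow hz (hasSum_intCoeff_mul_mul_pow hz h2 hg') hprod
    simp only [Nat.add_sub_cancel]
    convert h using 1
    have h2c : ((2 : ℤ_[p]) : ℚ_[p]) = 2 := map_ofNat (PadicInt.Coe.ringHom (p := p)) 2
    unfold characterLValueD twistedBernoulli
    rw [Nat.add_sub_cancel, one_div, h2c]
    ring
  · have hz : ‖ρ (cyclotomicGenerator p : ZMod (p ^ (n + 1))) - 1‖ < 1 :=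
      norm_apply_cyclotomicGenerator_sub_one_lt ρ hord
    have h2 : HasSum (fun k ↦ ((algebraMap ℚ_[p] ℂ_[p]).comp (algebraMap ℤ_[p] ℚ_[p]))
        (PowerSeries.coeff k (PowerSeries.C (2 : ℤ_[p]))) *
          (ρ (cyclotomicGenerator p : ZMod (p ^ (n + 1))) - 1) ^ k) 2 := by
      have h := hasSum_map_coeff_C_mul_pow ((algebraMap ℚ_[p] ℂ_[p]).comp (algebraMap ℤ_[p] ℚ_[p]))
        (2 : ℤ_[p]) (ρ (cyclotomicGenerator p : ZMod (p ^ (n + 1))) - 1)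
      rwa [map_ofNat ((algebraMap ℚ_[p] ℂ_[p]).comp (algebraMap ℤ_[p] ℚ_[p])) 2] at h
    have hg' := (hgchar n ρ heven hord).2
    have hprod := hasSum_cpCoeff_prod p S₀ e _ hz fun v hv ↦ (he v hv).2 (n + 1) ρ heven hord
    exact hasSum_cpCoeff_mul hz (hasSum_cpCoeff_mul hz h2 hg') hprod

/-- **Greenberg–Vatsal (27) (tree normalisation) for the tree's `L_{Σ₀}(D, T)`**: for every
`g ∈ Λ` with `IsCharacterLFunctionD p ψ Σ₀ g` (`p` odd, `ψ` modulo `d` with `p ∤ d`, `Σ₀ ∌ p`),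
every `n` and every character `ρ` of `Γ` of conductor dividing `p^{n+1}` (`ζ = ρ(γ)`),
`g(ζ − 1) = 2·(−∑_{i<M} θ(i)ρ⁻¹(i)B_1(i/M))·∏_{l∈Σ₀}(1 − ψ(l)ρ(l)l⁻¹)`, `θ = ψ⁻¹·1_{p∤·}`,
`M = dp·p^{n+1}` — i.e. `2·(−B_{1,ψ⁻¹ρ⁻¹}) ∏(1 − ψρ(l)l⁻¹) = 2·L(ψ⁻¹ρ⁻¹, 0)·∏_{l∈Σ₀}(1 − ψρ(l)l⁻¹)`:
the character `χ⁻¹ψ⁻¹ρ⁻¹` (`χ = 1`) of GV p. 42 (27) "`L(D, χ, ζ − 1) = … = ½ L(χ⁻¹ψ⁻¹ρ⁻¹, 0)`"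
and the Euler factors "`1 − χψρ(l)l⁻¹` in `L(χψρ, s)` at `s = 1`", in the normalisation of the
tree's predicate (p. 42 "`L_p(ωχ⁻¹ψ⁻¹, s) = ½ L(D, χ, κ(γ)^s − 1)`", whence the leading `2`; see
the READING NOTE in the module docstring on the factor `4` between GV's two sentences).
[cite: GreenbergVatsal2000, §3 p. 42 (display (27); L_p(ωχ⁻¹ψ⁻¹,s) = ½ L(D,χ,κ(γ)^s − 1); Σ₀-Euler factors at T = ζ − 1)]
[cite: LangCyclotomic1990, Ch. 2 §2 B 7 (B_{1,θ}) and Ch. 4 §3 Thm. 3.2] -/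
theorem IsCharacterLFunctionD.hasSum_character [NeZero d] (hp : p ≠ 2) (hpd : ¬ p ∣ d)
    (hS : ∀ v ∈ S₀, ((p : ℕ) : 𝓞 ℚ) ∉ v.asIdeal)
    {g : IwasawaAlgebra p} (hg : IsCharacterLFunctionD p ψ S₀ g) (n : ℕ)
    (ρ : DirichletCharacter ℂ_[p] (p ^ (n + 1))) (heven : ρ.Even) (hord : ∃ j : ℕ, orderOf ρ = p ^ j) :
    HasSum (fun k ↦ ((algebraMap ℚ_[p] ℂ_[p]).comp (algebraMap ℤ_[p] ℚ_[p]))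
        (PowerSeries.coeff k g) * (ρ (cyclotomicGenerator p : ZMod (p ^ (n + 1))) - 1) ^ k)
      (2 * (-(∑ i ∈ Finset.range (d * p * p ^ (n + 1)),
        ((algebraMap ℚ_[p] ℂ_[p]).comp (algebraMap ℤ_[p] ℚ_[p])) (oddCharacterTwist p ψ 1 i) *
          ρ⁻¹ (i : ZMod (p ^ (n + 1))) *
          (((Polynomial.bernoulli 1).eval ((i : ℚ) / (d * p * p ^ (n + 1) : ℕ)) : ℚ) : ℂ_[p]))) *
        ∏ v ∈ S₀, (1 - ((algebraMap ℚ_[p] ℂ_[p]).comp (algebraMap ℤ_[p] ℚ_[p]))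
          (teichmullerLift p (ψ (Rat.HeightOneSpectrum.natGenerator v : ZMod d))) *
            (Rat.HeightOneSpectrum.natGenerator v : ℂ_[p])⁻¹ *
            ρ (Rat.HeightOneSpectrum.natGenerator v : ZMod (p ^ (n + 1))))) := by
  have pp : p.Prime := Fact.out
  obtain ⟨g₀, hg₀, hchar⟩ := exists_isCharacterLFunctionD_character p ψ S₀ hp hpd hS
  rw [IsCharacterLFunctionD.unique ψ S₀ hg hg₀]
  haveI : NeZero (d * p * p ^ (n + 1)) :=
    ⟨mul_ne_zero (mul_ne_zero (NeZero.ne d) pp.ne_zero) (pow_ne_zero _ pp.ne_zero)⟩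
  have h := hchar n ρ heven hord
  rwa [sum_castHom_mul_bernoulliDist_one_eq p (Dvd.intro_left _ rfl) ρ⁻¹] at h

end D

end Literature.NumberTheory.EllipticCurves.GreenbergVatsal2000

end
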